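import Summits.Ventures.WeilGRH.FlatWindowMeanDefect
import HarnessLib

/-!
# GRH arm (rh-explicit, venture WeilGRH): THE FLAT WINDOWS DETERMINE THE EVEN SPECTRAL DATA —
  equal flat defects at all windows ⟹ equal second inverse moment and equal cosine transform of `t⁻²dμ`

Cell `rh-explicit`, WEIL TRACK (structure seat weil-3, gen9).  The flat-window defect of a rung family is
`a·D(a) = E(a) = ∫ 2sin²(at)/t² dμ` (`FlatWindowMeanDefect.flatWindow_defect_eq`).  Since
`2sin²(at) = 1 − cos(2at)`,

  `E(a) = M₂ − C(2a)`,  `M₂ = ∫ t⁻² dμ`,  `C(ξ) = ∫ cos(ξt) t⁻² dμ`   (`fejerEnergy_eq_sub_cosTransform`),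

and `M₂` is the Cesàro mean of `E` (`tendsto_average_fejerEnergy`, from `tendsto_integral_average_fejer`).
Hence (**`cosTransform_eq_of_fejerEnergy_eq`**): two σ-finite measures with `t⁻² ∈ L¹` whose Fejér energies
agree at every window `a > 0` have the same `M₂` and the same cosine transform `C(ξ)` for EVERY `ξ ∈ ℝ` —
the flat members of the rung family alone determine the even part of the finite measure `t⁻²dμ` (by the
uniqueness of characteristic functions of finite measures, `MeasureTheory.Measure.ext_of_charFun`, its
symmetrization is then determined; that last step is not typed here; `fejerEnergy_map_neg`: a measure and its reflection have the same energies, so nothing beyond the even part can be read off).  In rung language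
(**`cosTransform_eq_of_defect_eq`**): for two characters (any moduli) with all-window representing measures
`μ₁, μ₂`, equality of the prime-side defect functions `a ↦ a·D₁(a)`, `a ↦ a·D₂(a)` forces
`∫cos(ξt)t⁻²dμ₁ = ∫cos(ξt)t⁻²dμ₂` for all `ξ`.  No definitions, no named facts, RH/GRH-free.
-/

set_option autoImplicit false

noncomputable section

open Complex Filter Set MeasureTheory
open scoped Real Topology ComplexConjugate ArithmeticFunction.vonMangoldt

namespace Summit.Ventures.WeilGRH

open Literature.NumberTheory.LFunctions

variable {q₁ q₂ : ℕ}

/-- `cos(ξt)/t²` is integrable when `t⁻²` is. -/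
theorem integrable_cos_mul_div_sq {μ : Measure ℝ} (hM : Integrable (fun t : ℝ ↦ (t ^ 2)⁻¹) μ) (ξ : ℝ) :
    Integrable (fun t : ℝ ↦ Real.cos (ξ * t) / t ^ 2) μ := by
  refine hM.mono' (by fun_prop : Measurable fun t : ℝ ↦ Real.cos (ξ * t) / t ^ 2).aestronglyMeasurable
    (Eventually.of_forall fun t ↦ ?_)
  rw [Real.norm_eq_abs, abs_div, abs_of_nonneg (sq_nonneg t), div_eq_mul_inv]
  exact mul_le_of_le_one_left (by positivity) (Real.abs_cos_le_one _)

/-- **`E(a) = M₂ − C(2a)`**: `∫ 2sin²(at)/t² dμ = ∫ t⁻² dμ − ∫ cos(2at)/t² dμ`. -/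
theorem fejerEnergy_eq_sub_cosTransform {μ : Measure ℝ} (hM : Integrable (fun t : ℝ ↦ (t ^ 2)⁻¹) μ) (a : ℝ) :
    ∫ t, 2 * Real.sin (a * t) ^ 2 / t ^ 2 ∂μ = (∫ t, (t ^ 2)⁻¹ ∂μ) - ∫ t, Real.cos (2 * a * t) / t ^ 2 ∂μ := by
  rw [← integral_sub hM (integrable_cos_mul_div_sq hM (2 * a))]
  refine integral_congr_ae (Eventually.of_forall fun t ↦ ?_)
  show 2 * Real.sin (a * t) ^ 2 / t ^ 2 = (t ^ 2)⁻¹ - Real.cos (2 * a * t) / t ^ 2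
  have h : 2 * Real.sin (a * t) ^ 2 = 1 - Real.cos (2 * a * t) := by
    rw [Real.sin_sq, Real.cos_sq, show 2 * (a * t) = 2 * a * t by ring]; ring
  rw [h, sub_div, one_div]

/-- **`M₂` is the Cesàro mean of the Fejér energy** (measure level, σ-finite `μ`, `t⁻² ∈ L¹(μ)`):
`(1/A)∫₀^A E(a) da → ∫ t⁻² dμ`. -/
theorem tendsto_average_fejerEnergy {μ : Measure ℝ} [SFinite μ] (hM : Integrable (fun t : ℝ ↦ (t ^ 2)⁻¹) μ) :
    Tendsto (fun A : ℝ ↦ 1 / A * ∫ a in (0 : ℝ)..A, ∫ t, 2 * Real.sin (a * t) ^ 2 / t ^ 2 ∂μ) atTop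
      (𝓝 (∫ t, (t ^ 2)⁻¹ ∂μ)) := by
  have hev : ∀ᶠ A in atTop, ∫ t, (t ^ 2)⁻¹ * (1 - Real.sin (2 * A * t) / (2 * A * t)) ∂μ =
      1 / A * ∫ a in (0 : ℝ)..A, ∫ t, 2 * Real.sin (a * t) ^ 2 / t ^ 2 ∂μ := by
    filter_upwards [eventually_gt_atTop (0 : ℝ)] with A hA
    rw [intervalIntegral_integral_fejer_swap hM hA.le, ← integral_const_mul]
    exact integral_congr_ae (Eventually.of_forall fun t ↦ (average_fejer_eq hA t).symm)
  exact (tendsto_integral_average_fejer hM).congr' hev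

/-- **THE FLAT WINDOWS DETERMINE THE EVEN SPECTRAL DATA** (measure level).  Let `μ₁, μ₂` be σ-finite
measures on `ℝ` with `t⁻² ∈ L¹(μ_i)` whose Fejér energies agree at every window:
`∫2sin²(at)/t²dμ₁ = ∫2sin²(at)/t²dμ₂` for all `a > 0`.  Then `∫t⁻²dμ₁ = ∫t⁻²dμ₂` and
`∫cos(ξt)t⁻²dμ₁ = ∫cos(ξt)t⁻²dμ₂` for EVERY `ξ ∈ ℝ` (the characteristic function of the symmetrized
finite measure `t⁻²dμ` is determined). -/
theorem cosTransform_eq_of_fejerEnergy_eq {μ₁ μ₂ : Measure ℝ} [SFinite μ₁] [SFinite μ₂]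
    (hM₁ : Integrable (fun t : ℝ ↦ (t ^ 2)⁻¹) μ₁) (hM₂ : Integrable (fun t : ℝ ↦ (t ^ 2)⁻¹) μ₂)
    (h : ∀ a : ℝ, 0 < a →
      ∫ t, 2 * Real.sin (a * t) ^ 2 / t ^ 2 ∂μ₁ = ∫ t, 2 * Real.sin (a * t) ^ 2 / t ^ 2 ∂μ₂) :
    (∫ t, (t ^ 2)⁻¹ ∂μ₁) = (∫ t, (t ^ 2)⁻¹ ∂μ₂) ∧
      ∀ ξ : ℝ, ∫ t, Real.cos (ξ * t) / t ^ 2 ∂μ₁ = ∫ t, Real.cos (ξ * t) / t ^ 2 ∂μ₂ := by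
  -- the Cesàro means agree, hence the second inverse moments
  have hmean : (∫ t, (t ^ 2)⁻¹ ∂μ₁) = ∫ t, (t ^ 2)⁻¹ ∂μ₂ := by
    refine tendsto_nhds_unique (tendsto_average_fejerEnergy hM₁) ?_
    refine (tendsto_average_fejerEnergy hM₂).congr' ?_
    filter_upwards [eventually_gt_atTop (0 : ℝ)] with A hA
    congr 1
    refine intervalIntegral.integral_congr fun a ha ↦ ?_
    rw [Set.uIcc_of_le hA.le] at ha
    rcases ha.1.eq_or_lt with rfl | ha0
    · simp
    · exact (h a ha0).symm
  refine ⟨hmean, fun ξ ↦ ?_⟩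
  -- `C(ξ) = M₂ − E(|ξ|/2)`; cosine is even
  rcases eq_or_ne ξ 0 with rfl | hξ
  · simp only [zero_mul, Real.cos_zero, one_div]; exact hmean
  · have ha : 0 < |ξ| / 2 := div_pos (abs_pos.2 hξ) two_pos
    have hcos : ∀ t : ℝ, Real.cos (ξ * t) = Real.cos (2 * (|ξ| / 2) * t) := by
      intro t
      rw [show 2 * (|ξ| / 2) * t = |ξ| * t by ring]
      rcases le_or_gt 0 ξ with h0 | h0
      · rw [abs_of_nonneg h0]
      · rw [abs_of_neg h0, neg_mul, Real.cos_neg]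
    have e1 := fejerEnergy_eq_sub_cosTransform hM₁ (|ξ| / 2)
    have e2 := fejerEnergy_eq_sub_cosTransform hM₂ (|ξ| / 2)
    simp_rw [← hcos] at e1 e2
    have := h _ ha
    linarith

/-- **In rung language**: let `χ₁` mod `q₁ ≠ 1`, `χ₂` mod `q₂ ≠ 1` have all-window representing measures
`μ₁, μ₂` with `t⁻² ∈ L¹(μ_i)`.  If the normalized flat defects agree at every window,
`a·D₁(a) = a·D₂(a)` for all `a > 0` (`D_i(a) = log q_i − K_{κ_i} + I_{κ_i}(a)/a − 2S_{χ_i}(a) − 2a·μ_i{0}`,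
a PRIME-SIDE quantity), then `∫t⁻²dμ₁ = ∫t⁻²dμ₂` and `∫cos(ξt)t⁻²dμ₁ = ∫cos(ξt)t⁻²dμ₂` for every `ξ`:
the even part of the spectral data is read off the flat windows alone. -/
theorem cosTransform_eq_of_defect_eq (hq₁ : q₁ ≠ 1) (χ₁ : DirichletCharacter ℂ q₁) (hq₂ : q₂ ≠ 1)
    (χ₂ : DirichletCharacter ℂ q₂) {μ₁ μ₂ : Measure ℝ}
    (hμ₁ : ∀ g : ℝ → ℂ, IsWeilTest g →
      Integrable (fun t : ℝ ↦ ‖weilMellin g (1 / 2 + t * I)‖ ^ 2) μ₁ ∧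
        weilQuadraticChar χ₁ g = ((∫ t, ‖weilMellin g (1 / 2 + t * I)‖ ^ 2 ∂μ₁ : ℝ) : ℂ))
    (hμ₂ : ∀ g : ℝ → ℂ, IsWeilTest g →
      Integrable (fun t : ℝ ↦ ‖weilMellin g (1 / 2 + t * I)‖ ^ 2) μ₂ ∧
        weilQuadraticChar χ₂ g = ((∫ t, ‖weilMellin g (1 / 2 + t * I)‖ ^ 2 ∂μ₂ : ℝ) : ℂ))
    (hM₁ : Integrable (fun t : ℝ ↦ (t ^ 2)⁻¹) μ₁) (hM₂ : Integrable (fun t : ℝ ↦ (t ^ 2)⁻¹) μ₂)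
    (h : ∀ a : ℝ, 0 < a →
      a * (Real.log q₁ -
          (Real.log (4 * π) + Real.eulerMascheroniConstant +
            2 * ∫ t in Ioi (0 : ℝ), weilKillingDensityPar (charParity χ₁) t) +
          1 / a * (∫ t in Ioi (0 : ℝ), weilArchDensityPar (charParity χ₁) t * min t (2 * a)) -
          2 * (∑ n ∈ weilPrimeIndex a,
            (Λ n : ℝ) / Real.sqrt n * ((1 - Real.log n / (2 * a)) * (χ₁ (n : ZMod q₁)).re)) -
          2 * a * μ₁.real {0}) =
      a * (Real.log q₂ -
          (Real.log (4 * π) + Real.eulerMascheroniConstant +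
            2 * ∫ t in Ioi (0 : ℝ), weilKillingDensityPar (charParity χ₂) t) +
          1 / a * (∫ t in Ioi (0 : ℝ), weilArchDensityPar (charParity χ₂) t * min t (2 * a)) -
          2 * (∑ n ∈ weilPrimeIndex a,
            (Λ n : ℝ) / Real.sqrt n * ((1 - Real.log n / (2 * a)) * (χ₂ (n : ZMod q₂)).re)) -
          2 * a * μ₂.real {0})) :
    (∫ t, (t ^ 2)⁻¹ ∂μ₁) = (∫ t, (t ^ 2)⁻¹ ∂μ₂) ∧
      ∀ ξ : ℝ, ∫ t, Real.cos (ξ * t) / t ^ 2 ∂μ₁ = ∫ t, Real.cos (ξ * t) / t ^ 2 ∂μ₂ := by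
  haveI : SigmaFinite μ₁ := sigmaFinite_of_integrable_inv_one_add_sq
    (integrable_inv_one_add_sq_of_represents χ₁ one_pos (fun g hg _ ↦ hμ₁ g hg))
  haveI : SigmaFinite μ₂ := sigmaFinite_of_integrable_inv_one_add_sq
    (integrable_inv_one_add_sq_of_represents χ₂ one_pos (fun g hg _ ↦ hμ₂ g hg))
  refine cosTransform_eq_of_fejerEnergy_eq hM₁ hM₂ fun a ha ↦ ?_
  -- `E_i(a) = a·D_i(a)`
  have hE : ∀ {q : ℕ} (hq : q ≠ 1) (χ : DirichletCharacter ℂ q) {μ : Measure ℝ},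
      (∀ g : ℝ → ℂ, IsWeilTest g →
        Integrable (fun t : ℝ ↦ ‖weilMellin g (1 / 2 + t * I)‖ ^ 2) μ ∧
          weilQuadraticChar χ g = ((∫ t, ‖weilMellin g (1 / 2 + t * I)‖ ^ 2 ∂μ : ℝ) : ℂ)) →
      ∫ t, 2 * Real.sin (a * t) ^ 2 / t ^ 2 ∂μ =
        a * (Real.log q -
          (Real.log (4 * π) + Real.eulerMascheroniConstant +
            2 * ∫ t in Ioi (0 : ℝ), weilKillingDensityPar (charParity χ) t) +
          1 / a * (∫ t in Ioi (0 : ℝ), weilArchDensityPar (charParity χ) t * min t (2 * a)) -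
          2 * (∑ n ∈ weilPrimeIndex a,
            (Λ n : ℝ) / Real.sqrt n * ((1 - Real.log n / (2 * a)) * (χ (n : ZMod q)).re)) -
          2 * a * μ.real {0}) := by
    intro q hq χ μ hμ
    obtain ⟨hF, heq⟩ := flatWindow_defect_eq hq χ ha (fun g hg _ ↦ hμ g hg)
    rw [heq, ← integral_const_mul]
    refine integral_congr_ae (Eventually.of_forall fun t ↦ ?_)
    show 2 * Real.sin (a * t) ^ 2 / t ^ 2 = a * (2 * Real.sin (a * t) ^ 2 / (a * t ^ 2))
    rcases eq_or_ne t 0 with rfl | ht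
    · simp
    · field_simp
  rw [hE hq₁ χ₁ hμ₁, hE hq₂ χ₂ hμ₂]
  exact h a ha

/-- **…and nothing more: the flat windows are blind to reflection.**  The Fejér energies of a measure and
of its reflection `t ↦ −t` coincide at every window (`sin²` is even), so the even part of `t⁻²dμ` is the
most the flat family can determine. -/
theorem fejerEnergy_map_neg (μ : Measure ℝ) (a : ℝ) :
    ∫ t, 2 * Real.sin (a * t) ^ 2 / t ^ 2 ∂(μ.map Neg.neg) = ∫ t, 2 * Real.sin (a * t) ^ 2 / t ^ 2 ∂μ := by
  rw [integral_map measurable_neg.aemeasurable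
    (by fun_prop : Measurable fun t : ℝ ↦ 2 * Real.sin (a * t) ^ 2 / t ^ 2).aestronglyMeasurable]
  refine integral_congr_ae (Eventually.of_forall fun t ↦ ?_)
  show 2 * Real.sin (a * -t) ^ 2 / (-t) ^ 2 = 2 * Real.sin (a * t) ^ 2 / t ^ 2
  rw [mul_neg, Real.sin_neg, neg_sq, neg_sq]

end Summit.Ventures.WeilGRH

end
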